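import Summits.ValiantsHypothesis.ValiantsHypothesis.Theses.VPBoundarySquare
import Literature.Computability.MetaComplexity.RandReductionsLeak
import HarnessLib

/-!
# VPBoundarySquare — U_CH self-uniformises: the UNIFORM `CH` COVER of the border at finite levels
(decomp-valiant lens 3, NODE v11, theorem T5 «definability/choice coordinate»)

`CHClosureDefinable` (U_CH, item 24721) quantifies over FAMILIES: every `\overline{VP}` p-family `f` is
`f_n = Q_n(x, κ_n)` for SOME `Q ∈ VCH⁰` (exponential format, coefficient bits in `CH/poly`) and
`κ_n ∈ ℂ^{w n}`. All its content sits in the uniform constants (for one polynomial nothing is asserted).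
This file makes the finite-level content explicit and proves that U_CH IMPLIES it:

* `IsBorderPoint d n g` — a single polynomial `g ∈ ℂ[x_1..x_u]` of budget `d` at level `n`:
  `u, deg g, \underline{L}(g) ≤ n^d + d` (exactly the pointwise content of `IsPFamily ∧ IsVPBarFamily`);
* `IsChart L' c n Q` — an integer polynomial `Q ∈ ℤ[x_1..x_u, y_1..y_w]` of format `c` at level `n`
  (`u + w ≤ n^c + c`, `deg Q ≤ 2^{n^c+c}`, coefficients `< 2^{2^{n^c+c}}`) whose coefficient-bit queries
  `⟨1ⁿ, ⟨code e, bin a⟩⟩` (the tree's `expCoeffQuery`, `coeffFnBit`) are answered by the FIXED language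
  `L'` through SOME advice strings of length `≤ ℓ^c + c` per query length `ℓ` — the advice is the
  discrete CHOICE coordinate («which chart»), `2^{poly(n)}` possibilities at level `n`;
* `Covered L' c n g` — `g = Q(x, κ)` for such a chart and some `κ ∈ ℂ^w`;
* `UniformCHCover d` — ONE language `L' ∈ CH` and ONE constant `c` such that, for all large `n`, EVERY
  border point of budget `d` at level `n` is covered: `∂`-and-interior of `{\underline{L} ≤ n^d + d}` is
  contained in the union of the `2^{poly(n)}` chart images `Q_{n,a}(x, ℂ^{w})`, `a` = advice.

Main theorem `uniformCHCover_of_chClosureDefinable : CHClosureDefinable → ∀ d, UniformCHCover d`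
(a diagonal / compactness argument: `CH` is COUNTABLE — `countable_CkP`, from the tree's `countable_P`
and the shape of the majority operator — so if no pair `(L', c)` eventually covered budget `d`, an
injective selection of escape levels (`exists_injective_selection`) assembles the escaping border points
into ONE `\overline{VP}` p-family, which U_CH would cover by one pair `(L', c)` at one of its own escape
levels). Contrapositive, the refuter's form: `not_chClosureDefinable_of_not_uniformCHCover`.

Why this is the definability/CHOICE-typed rung asked for (critic g9 order, R1 test): the statement
bounds WHICH polynomial is chosen — a `CH` language plus `poly(n)` advice bits select the skeleton of
every border point — and says nothing new about degree/height/sparsity of `g` (those are the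
`VNP`-blind format shadows of T4/T4-cal). The converse `(∀ d, UniformCHCover d at all levels) →
CHClosureDefinable` holds at paper level by merging the per-level advice strings into one advice
function, which needs closure of `CH` under polynomial-time re-pairing (a machine construction the tree
keeps as named facts, cf. `PPoly_eq_polyAdvice_P`); it is NOT claimed here.

Honest scope: no statement of record changes; nothing here proves U_CH, `UniformCHCover d`, or bears on
`VP ≠ VNP`, which is NOT proved. 0 sorry. Sources: Bürgisser 2026, Def. 4.1–4.2 (`VCH⁰`, coefficient
function with `1ⁿ` unary) [cite: Burgisser2026HNC, Def. 4.1–4.2 (p. 11)]; BLMW 2011 Def. 9.3.1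
(`\underline{L}`) [cite: BurgisserEtAl2011, Def. 9.3.1]; Arora–Barak 2009 §1.4 (machines as strings:
countability of `P`) [cite: AroraBarak2009, §1.4].
-/

noncomputable section

set_option linter.dupNamespace false

open MvPolynomial
open Literature.Computability.AlgebraicComplexity Literature.Computability.Complexity _root_.Computability

namespace Summit.ValiantsHypothesis.ValiantsHypothesis.Theorems.VPBoundarySquareUniformCover

open Summit.ValiantsHypothesis.ValiantsHypothesis.Theses.VPBoundarySquare

/-! ### The finite-level objects -/

/-- **A border point of budget `d` at level `n`**: a polynomial `g ∈ ℂ[x_1..x_u]` with `u ≤ n^d + d`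
variables, `deg g ≤ n^d + d` and approximate (border) complexity `\underline{L}(g) ≤ n^d + d` — the
pointwise content of «`(g_n)` is a p-family in `\overline{VP}`». [cite: BurgisserEtAl2011, Def. 9.3.1] -/
def IsBorderPoint (d n : ℕ) {u : ℕ} (g : MvPolynomial (Fin u) ℂ) : Prop :=
  u ≤ n ^ d + d ∧ g.totalDegree ≤ n ^ d + d ∧ approxComplexity g ≤ n ^ d + d

/-- **A `CH`-described chart of format `c` at level `n`**: an integer polynomial `Q ∈ ℤ[x_1..x_u, y_1..y_w]`
with `u + w ≤ n^c + c`, `deg Q ≤ 2^{n^c+c}`, all coefficients of absolute value `< 2^{2^{n^c+c}}`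
(Bürgisser's exponential format at level `n`), whose coefficient bits `coeffFnBit Q e a` are answered by
the language `L'` on the queries `⟨expCoeffQuery n e a, advice⟩` for SOME advice strings of length
`≤ ℓ^c + c` per query length `ℓ` (the advice = the discrete choice of the chart).
[cite: Burgisser2026HNC, Def. 4.1–4.2 (p. 11)] -/
def IsChart (L' : Language Bool) (c n : ℕ) {u w : ℕ} (Q : MvPolynomial (Fin (u + w)) ℤ) : Prop :=
  u + w ≤ n ^ c + c ∧ Q.totalDegree ≤ 2 ^ (n ^ c + c) ∧
    (∀ e : Fin (u + w) →₀ ℕ, (coeff e Q).natAbs < 2 ^ 2 ^ (n ^ c + c)) ∧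
    ∃ adv : ℕ → List Bool, (∀ ℓ, (adv ℓ).length ≤ ℓ ^ c + c) ∧
      ∀ (e : Fin (u + w) →₀ ℕ) (a : ℕ),
        boolPair (expCoeffQuery n e a) (adv (expCoeffQuery n e a).length) ∈ L' ↔
          coeffFnBit Q e a = true

/-- **`g` is covered by the charts of `(L', c)` at level `n`**: `g = Q(x, κ)` for a chart `Q` of
format `c` described by `L'` and some complex parameters `κ ∈ ℂ^w`. [cite: Burgisser2026HNC, Def. 4.2 (p. 11)] -/
def Covered (L' : Language Bool) (c n : ℕ) {u : ℕ} (g : MvPolynomial (Fin u) ℂ) : Prop :=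
  ∃ (w : ℕ) (Q : MvPolynomial (Fin (u + w)) ℤ) (κ : Fin w → ℂ), IsChart L' c n Q ∧
    g = aeval (Fin.append X fun j => C (κ j)) (MvPolynomial.map (Int.castRingHom ℂ) Q)

/-- **UNIFORM `CH` COVER of the border at budget `d`**: ONE language `L' ∈ CH` and ONE format/advice
constant `c` such that for all large levels `n` EVERY border point of budget `d` at level `n` is covered
by the (at most `2^{poly(n)}`) charts of `(L', c)`. The finite-level, choice-typed content of U_CH.
[cite: Burgisser2026HNC, Def. 4.2 (p. 11)] [cite: BurgisserEtAl2011, Def. 9.3.1] -/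
def UniformCHCover (d : ℕ) : Prop :=
  ∃ L' ∈ CH, ∃ c N : ℕ, ∀ n, N ≤ n → ∀ (u : ℕ) (g : MvPolynomial (Fin u) ℂ),
    IsBorderPoint d n g → Covered L' c n g

/-! ### `CH` is countable -/

/-- The majority operator preserves countability: a witness `(L', p)` determines the language.
[cite: AroraBarak2009, §1.4] -/
theorem countable_pMajority {K : Set (Language Bool)} (hK : K.Countable) : (pMajority K).Countable := by
  haveI : Countable (Polynomial ℕ) :=
    (AddMonoidAlgebra.coeff_injective.comp Polynomial.toFinsupp_injective).countable
  let gf : Language Bool × Polynomial ℕ → Language Bool := fun D =>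
    {x | 1 / 2 < uniformProb (D.2.eval x.length) {y : List Bool | boolPair x y ∈ D.1}}
  have hcov : pMajority K ⊆ gf '' (K ×ˢ (Set.univ : Set (Polynomial ℕ))) := by
    rintro L ⟨L', hL', p, hp⟩
    refine ⟨(L', p), ⟨hL', Set.mem_univ _⟩, ?_⟩
    ext x
    exact (hp x).symm
  exact ((hK.prod Set.countable_univ).image gf).mono hcov

/-- **Every level `C_kP` of Wagner's counting hierarchy is a countable set of languages** (`P` is
countable — the tree's `countable_P`, machines as strings — and `C_{k+1}P = C'·C_kP` is the image of
`C_kP × ℕ[X]`); hence `CH = ⋃_k C_kP` is countable (`Set.countable_iUnion countable_CkP`, used below).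
[cite: AroraBarak2009, §1.4] -/
theorem countable_CkP (k : ℕ) : (CkP k).Countable := by
  induction k with
  | zero => simpa using Literature.Computability.MetaComplexity.countable_P
  | succ k ih => rw [CkP_succ]; exact countable_pMajority ih

/-! ### The diagonal selection -/

/-- **Injective selection of escape levels.** If every `t` of a countable index type escapes at
arbitrarily large levels, one can choose pairwise distinct escape levels `lev t` (greedy along an
enumeration). [folklore] -/
theorem exists_injective_selection {D : Type*} [Countable D] {Esc : D → ℕ → Prop}
    (h : ∀ t N, ∃ n, N ≤ n ∧ Esc t n) :
    ∃ lev : D → ℕ, Function.Injective lev ∧ ∀ t, Esc t (lev t) := by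
  classical
  obtain ⟨enc, henc⟩ := Countable.exists_injective_nat D
  choose esc hesc_ge hesc using h
  -- `B i` : a level above every level selected for the indices `< i`
  let B : ℕ → ℕ := fun i => Nat.rec 0
    (fun j b => if hj : ∃ t, enc t = j then esc hj.choose b + 1 else b + 1) i
  have hB_succ : ∀ j, B (j + 1) = if hj : ∃ t, enc t = j then esc hj.choose (B j) + 1 else B j + 1 :=
    fun j => rfl
  have hB_step : ∀ j, B j + 1 ≤ B (j + 1) := by
    intro j
    rw [hB_succ]
    split_ifs with hj
    · exact Nat.succ_le_succ (hesc_ge _ _)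
    · exact le_rfl
  have hB_mono : ∀ {i j}, i ≤ j → B i ≤ B j := by
    intro i j hij
    induction hij with
    | refl => exact le_rfl
    | step _ ih => exact ih.trans ((Nat.le_succ _).trans (hB_step _))
  refine ⟨fun t => esc t (B (enc t)), ?_, fun t => hesc t _⟩
  -- the level of `t` lies in `[B (enc t), B (enc t + 1))`
  have hlt : ∀ t, esc t (B (enc t)) < B (enc t + 1) := by
    intro t
    have hj : ∃ t', enc t' = enc t := ⟨t, rfl⟩
    have ht' : hj.choose = t := henc hj.choose_spec
    rw [hB_succ, dif_pos hj, ht']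
    exact Nat.lt_succ_self _
  intro t t' htt'
  by_contra hne
  have hne' : enc t ≠ enc t' := fun h' => hne (henc h')
  rcases lt_or_gt_of_ne hne' with hlt' | hgt'
  · have : esc t (B (enc t)) < esc t' (B (enc t')) :=
      (hlt t).trans_le ((hB_mono (Nat.succ_le_of_lt hlt')).trans (hesc_ge _ _))
    exact absurd htt' this.ne
  · have : esc t' (B (enc t')) < esc t (B (enc t)) :=
      (hlt t').trans_le ((hB_mono (Nat.succ_le_of_lt hgt')).trans (hesc_ge _ _))
    exact absurd htt' this.ne'

/-! ### Small facts -/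

/-- The zero polynomial in no variables is a border point of every budget at every level
(`\underline{L}(0) ≤ L(0) = L(C 0) = 0`). [cite: Burgisser2000, Def. 2.1] -/
theorem isBorderPoint_zero (d n : ℕ) : IsBorderPoint d n (0 : MvPolynomial (Fin 0) ℂ) := by
  refine ⟨Nat.zero_le _, by simp, ?_⟩
  have h0 : complexity (0 : MvPolynomial (Fin 0) ℂ) = 0 := by
    have := complexity_C_holds (k := ℂ) (σ := Fin 0) 0
    rwa [C_0] at this
  exact (approxComplexity_le_complexity _).trans (h0.le.trans (Nat.zero_le _))

/-! ### The theorem -/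

/-- ★ **U_CH self-uniformises: `CHClosureDefinable → ∀ d, UniformCHCover d`.** If every `\overline{VP}`
p-family has a `VCH⁰` skeleton with complex parameters, then for every budget `d` ONE language `L' ∈ CH`
and ONE constant `c` cover, at all large levels `n`, EVERY border point of budget `d` by the
`2^{poly(n)}` exponential-format charts `Q_{n,a}(x, ℂ^w)` described by `L'` with advice `a`. Proof:
diagonalisation over the countable set `CH × ℕ` (`countable_CkP`, `exists_injective_selection`).
[cite: Burgisser2026HNC, Def. 4.1–4.2 (p. 11)] [cite: BurgisserEtAl2011, Def. 9.3.1] [cite: AroraBarak2009, §1.4] -/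
theorem uniformCHCover_of_chClosureDefinable (hU : CHClosureDefinable) (d : ℕ) : UniformCHCover d := by
  classical
  by_contra hneg
  have hneg' : ∀ L', L' ∈ CH → ∀ c N : ℕ, ∃ n, N ≤ n ∧ ∃ (u : ℕ) (g : MvPolynomial (Fin u) ℂ),
      IsBorderPoint d n g ∧ ¬ Covered L' c n g := by
    simpa [UniformCHCover] using hneg
  -- the countable index set of data `(L' ∈ CH, c)`
  haveI : Countable {L : Language Bool // L ∈ CH} :=
    (Set.countable_iUnion countable_CkP : (CH : Set (Language Bool)).Countable).to_subtype
  let D : Type := {L : Language Bool // L ∈ CH} × ℕ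
  have hEsc : ∀ (t : D) (N : ℕ), ∃ n, N ≤ n ∧ ∃ (u : ℕ) (g : MvPolynomial (Fin u) ℂ),
      IsBorderPoint d n g ∧ ¬ Covered (t.1 : Language Bool) t.2 n g :=
    fun t N => hneg' t.1.1 t.1.2 t.2 N
  obtain ⟨lev, hinj, hlev⟩ := exists_injective_selection hEsc
  choose u g hbp hnc using hlev
  -- the diagonal family, as a function into `Σ u, ℂ[x_1..x_u]`
  obtain ⟨pick, hpick_bp, hpick_eq⟩ : ∃ pick : ℕ → Σ u : ℕ, MvPolynomial (Fin u) ℂ,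
      (∀ n, IsBorderPoint d n (pick n).2) ∧ ∀ t, pick (lev t) = ⟨u t, g t⟩ := by
    refine ⟨fun n => if h : ∃ t, lev t = n then ⟨u h.choose, g h.choose⟩ else ⟨0, 0⟩, ?_, ?_⟩
    · intro n
      by_cases h : ∃ t, lev t = n
      · have key := hbp h.choose
        rw [h.choose_spec] at key
        beta_reduce
        rw [dif_pos h]
        exact key
      · beta_reduce
        rw [dif_neg h]
        exact isBorderPoint_zero d n
    · intro t
      have h : ∃ t', lev t' = lev t := ⟨t, rfl⟩
      have ht : h.choose = t := hinj h.choose_spec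
      simp only [dif_pos h]
      rw [ht]
  -- it is a `\overline{VP}` p-family of budget `d`
  have hPF : IsPFamily (fun n => (pick n).2) :=
    ⟨⟨d, fun n => by simpa [Fintype.card_fin] using (hpick_bp n).1⟩, ⟨d, fun n => (hpick_bp n).2.1⟩⟩
  have hBar : IsVPBarFamily (fun n => (pick n).2) := ⟨d, fun n => (hpick_bp n).2.2⟩
  -- U_CH covers it by ONE datum `(L', c)`
  obtain ⟨w, Q, κ, ⟨⟨p, hp, hfmt⟩, L, hL, hbits⟩, hf⟩ := hU (fun n => (pick n).1) (fun n => (pick n).2) hPF hBar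
  obtain ⟨L', hL', adv, q, hq, hLL'⟩ := hL
  have hqb : IsPBounded fun ℓ => q.eval ℓ :=
    (isPBounded_iff_exists_polynomial_holds fun ℓ => q.eval ℓ).2 ⟨q, fun _ => le_rfl⟩
  -- ONE constant `c` dominating the format bound `p` and the advice bound `q`
  obtain ⟨c, hc⟩ := IsPBounded.add_holds hp hqb
  have hp_le : ∀ n, p n ≤ n ^ c + c := fun n => (Nat.le_add_right _ _).trans (hc n)
  have hq_le : ∀ ℓ, (adv ℓ).length ≤ ℓ ^ c + c :=
    fun ℓ => (hq ℓ).trans ((Nat.le_add_left _ _).trans (hc ℓ))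
  have hcov : ∀ n, Covered L' c n (pick n).2 := by
    intro n
    refine ⟨w n, Q n, κ n, ⟨(hfmt n).1.trans (hp_le n), ?_, ?_, adv, hq_le, fun e a => ?_⟩, hf n⟩
    · exact (hfmt n).2.1.trans (Nat.pow_le_pow_right (by norm_num) (hp_le n))
    · exact fun e => ((hfmt n).2.2 e).trans_le
        (Nat.pow_le_pow_right (by norm_num) (Nat.pow_le_pow_right (by norm_num) (hp_le n)))
    · exact (hLL' _).symm.trans (hbits n e a)
  -- … in particular at the escape level of that very datum: contradiction
  let t₀ : D := (⟨L', hL'⟩, c)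
  have key := hcov (lev t₀)
  rw [hpick_eq t₀] at key
  exact hnc t₀ key

/-- **The refuter's form**: to refute U_CH it suffices to exhibit ONE budget `d` at which no pair
`(L' ∈ CH, c)` eventually covers all border points — i.e. for every `L' ∈ CH` and `c`, border points
of budget `d` escaping all `2^{poly(n)}` charts of `(L', c)` exist at arbitrarily large levels.
[cite: Burgisser2026HNC, Def. 4.2 (p. 11)] -/
theorem not_chClosureDefinable_of_not_uniformCHCover {d : ℕ} (h : ¬ UniformCHCover d) :
    ¬ CHClosureDefinable :=
  fun hU => h (uniformCHCover_of_chClosureDefinable hU d)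

end Summit.ValiantsHypothesis.ValiantsHypothesis.Theorems.VPBoundarySquareUniformCover

end
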